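import Mathlib
import Summits.ResolutionOfSingularities.ResolutionOfSingularities.Theorems.WeightedInvariantLocalWeightedDropWildMonicFlagAttainRecentreMax
import Summits.ResolutionOfSingularities.ResolutionOfSingularities.Theorems.WeightedInvariantLocalWeightedDropWildMonicFlagAttainShape
import Summits.ResolutionOfSingularities.ResolutionOfSingularities.Theorems.WeightedInvariantLocalWeightedDropWildMonicFlagCompanionReading
import Summits.ResolutionOfSingularities.ResolutionOfSingularities.Theorems.WeightedInvariantLocalWeightedDropWildMonicFlagDropTangentInduced
import Summits.ResolutionOfSingularities.ResolutionOfSingularities.Theorems.WeightedInvariantLocalWeightedDropWildMonicFlagPos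

/-!
# `WeightedInvariant.LocalWeightedDrop`, line `hasse-ridge-face-selection`, S3ρ sub-stub S3ρD `stub_wildMonicSurfaceDescent`: item D-0
# «maximising flag» — THE BRIDGE from `s`-attainment over re-centrings (Per17 Prop. 5.3.5) to the top-class hypothesis `hattain₀`
# of `WildMonic.attainShape_isFlagTriple_of`

Crux item stmt-ResolutionOfSingularities-8899 `LocalWeightedDrop` (route `ResolutionOfSingularities/WeightedInvariant`), engine of the door
`HypersurfaceCentreConstruction` stmt-ResolutionOfSingularities-19897.  [OURS · L1 W4.3, chain w43, res-L1-w43-stub-3 (gen 4) on roadmap item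
D-0 of `L/res-L1-w43-stub-7/S3RHOD-ROADMAP.md` (owners res-type-083 / stub-7); spec `L/res-L1-w43-stub-3/D0-SPEC.md` §8; split with
res-D-pv-056 AS stub-5 (STATUS 2026-08-27T09:15:07Z: the pair family (β) `…WildMonicFlagAttainPair` is theirs, this bridge is ours).
MODEL: S. Perlega, thesis Wien 2017 / arXiv:2011.14443 §7.4.3 (Props. 7.4.5 (3), 7.4.6, 7.4.10, Lemma 7.4.11) with §5.3 Prop. 5.3.5.
Nothing here is a statement of H. Hironaka's manuscript; every object is OURS; AI-written, gate-accepted means sorry-free with standard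
axioms, not refereed.  Definition-free.]

* §2 THE COORDINATE CLASS (`h = 0`, the curve letter `1 ∈ E`): **`exists_isGreatest_sValue_recentre`** — among the VALID re-centrings
  `g` (`IsMMax`, Per17 §7.2.3) with residual order `dRes = D > 0`, `D` bounding the residual order of every valid re-centring, the
  `s`-entry `sValue d!` is finite and ATTAINS ITS MAXIMUM (both regimes `D ≥ d!` and `0 < D < d!`, the latter through
  `…WildMonicFlagCompanionReading.sValue_le_sValue_of_sFlag_le`).  Proof: validity ⟺ `|excExp| = M` (the maximal `m`,
  `isMMax_iff_mOf_eq`); the class is a FINITE union, over the occurring exceptional exponents `r ≤ (M, M)`, of the setting classes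
  `(D, r)` of `exists_isGreatest_sFlag_shift` (`…FlagAttainRecentreMax`, p515426), whose maximality hypothesis `hmax` is DISCHARGED
  here from validity + topness (`r ≤ excExp g` on `E` and `D + |r| ≤ dRes g + |excExp g|` force `excExp g = r`, so `g` is valid, so
  `dRes g ≤ D`); `hnz` is `¬ Exit₃` (`newtonSet_flagTuple_nonempty`), `hfin` is `sFlag_ne_top_of_one_mem`; the finite union is glued
  by `exists_isGreatest_of_finite_classes`.
* §3 THE TOP CLASS: `exists_isGreatest_sValue_orient` (one orientation) and **`hattain₀_of_pairAttain`** — the conclusion of the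
  hypothesis `hattain₀` of `attainShape_isFlagTriple_of` (`…FlagAttainShape`, p514376) at a position `(A, E)` with top residual order
  `D`, from §2 for the orientations whose boundary contains the curve letter (`1 ∈ orientE o E`: the `n = 0` flags there have `h = 0`)
  and from the PAIR ATTAINMENT of the other orientations, taken as the hypothesis `hpair` in the shape stub-5's `…FlagAttainPair` is to
  conclude (Per17 Prop. 5.3.5 proper, pairs `(g, h)`); **`hattain₀_univ`** — for the full boundary `E = Finset.univ` both orientations
  are coordinate classes and `hattain₀` holds OUTRIGHT.
WHAT REMAINS of `hattain₀` after this file: `hpair` for the boundaries `∅`, `{0}`, `{1}` (one or both orientations) = Per17 §5.3.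
-/

set_option linter.dupNamespace false -- mandated namespace of this single-conjunct summit

namespace Summit.ResolutionOfSingularities.ResolutionOfSingularities.Theorems

namespace WildMonic

open MvPowerSeries MonicDescent
open Literature.AlgebraicGeometry.Resolution
open Literature.AlgebraicGeometry.Resolution.HauserPerlega2024 (Triple)
open PurePowerFlag (swap swapE orient orientE IsN0 IsTangent)

variable {k : Type} [Field k] {d : ℕ}

/-! ## §2 The coordinate class: valid re-centrings with the top residual order -/

/-- GLUE: greatest elements of finitely many classes give a greatest element of their union (values in a linear order). -/
theorem exists_isGreatest_of_finite_classes {α ι : Type*} (K : Set α) (c : α → ι) (f : α → ℕ∞) (hfin : (c '' K).Finite)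
    (hK : K.Nonempty) (hcl : ∀ i ∈ c '' K, ∃ a ∈ K, c a = i ∧ f a ≠ ⊤ ∧ ∀ b ∈ K, c b = i → f b ≤ f a) :
    ∃ a ∈ K, f a ≠ ⊤ ∧ ∀ b ∈ K, f b ≤ f a := by
  classical
  let a : ι → α := fun i => if h : i ∈ c '' K then (hcl i h).choose else hK.some
  have ha : ∀ i (hi : i ∈ c '' K), a i ∈ K ∧ c (a i) = i ∧ f (a i) ≠ ⊤ ∧ ∀ b ∈ K, c b = i → f b ≤ f (a i) := by
    intro i hi
    simp only [a, dif_pos hi]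
    exact (hcl i hi).choose_spec
  obtain ⟨i₀, hi₀, hmax⟩ := Set.exists_max_image (c '' K) (fun i => f (a i)) hfin (hK.image c)
  refine ⟨a i₀, (ha i₀ hi₀).1, (ha i₀ hi₀).2.2.1, fun b hb => ?_⟩
  exact ((ha (c b) ⟨b, hb, rfl⟩).2.2.2 b hb rfl).trans (hmax (c b) ⟨b, hb, rfl⟩)

/-- The triple of a coordinate flag (`h = 0`): `(dRes, 0, sValue d!)` of the re-centred tuple. -/
theorem flagTriple_zero_shear (A : Fin d → MvPowerSeries (Fin 2) k) (E : Finset (Fin 2)) (g : MvPowerSeries (Fin 2) k) :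
    flagTriple d A E g 0 =
      toLex (dRes E (newtonSet (shift d A g)), toLex (0, sValue d.factorial E (newtonSet (shift d A g)))) := by
  rw [flagTriple_of_isN0 (Or.inr rfl), flagTuple_zero_shear]

/-- VALIDITY IS «`m` EQUALS THE MAXIMAL `m`»: given one valid re-centring `g₁`, a re-centring `g` is valid iff `m(g) = m(g₁)`. -/
theorem isMMax_iff_mOf_eq {A : Fin d → MvPowerSeries (Fin 2) k} {E : Finset (Fin 2)} {g₁ g : MvPowerSeries (Fin 2) k}
    {h : PowerSeries k} (hg₁ : constantCoeff g₁ = 0) (hmax₁ : IsMMax d A E g₁ h) (hg : constantCoeff g = 0) :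
    IsMMax d A E g h ↔ mOf d A E g h = mOf d A E g₁ h :=
  ⟨fun hm => le_antisymm (hmax₁ g hg) (hm g₁ hg₁), fun hm g' hg' => hm ▸ hmax₁ g' hg'⟩

section Recentre

variable {p : ℕ}

/-- The letter swap of a non-`Exit₃` position is non-`Exit₃` (`exit₃_of_swap`), for either orientation. -/
theorem not_exit₃_orientT (o : Bool) {A : Fin d → MvPowerSeries (Fin 2) k} (hex : ¬ Exit₃ p d A) : ¬ Exit₃ p d (orientT o A) := by
  cases o
  · exact hex
  · exact fun h => hex (exit₃_of_swap h)

/-- **THE COORDINATE CLASS ATTAINS `s`** (Per17 Props. 7.4.5 (3) / 7.4.6 with Prop. 5.3.5, plane flag `V(y, x₂)` fixed, `V(x₂)` a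
boundary component): at a non-`Exit₃` position, among the VALID re-centrings `g` (`IsMMax`) with residual order `dRes = D > 0`, where `D`
bounds the residual order of every valid re-centring, the `s`-entry `sValue d!` is FINITE and ATTAINS ITS MAXIMUM — both in the case
`D ≥ d!` (`sFlag`) and in the companion case `0 < D < d!` (`sComp`, by `sComp_eq_min`).  The class is non-empty by hypothesis.
[cite: Perlega2020, Props. 7.4.5 (3), 7.4.6, 5.3.5, Lemma 7.4.11 (arXiv:2011.14443 chunks p0092 L150 – p0093 L45, p0066)] -/
theorem exists_isGreatest_sValue_recentre (hd : 0 < d) {A : Fin d → MvPowerSeries (Fin 2) k} {E : Finset (Fin 2)}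
    (hex : ¬ Exit₃ p d A) (h1 : (1 : Fin 2) ∈ E) {D : ℕ} (hD : 0 < D)
    (htop : ∀ g : MvPowerSeries (Fin 2) k, constantCoeff g = 0 → IsMMax d A E g 0 → dRes E (newtonSet (shift d A g)) ≤ D)
    (hne : ∃ g : MvPowerSeries (Fin 2) k, constantCoeff g = 0 ∧ IsMMax d A E g 0 ∧ dRes E (newtonSet (shift d A g)) = D) :
    ∃ g : MvPowerSeries (Fin 2) k, constantCoeff g = 0 ∧ IsMMax d A E g 0 ∧ dRes E (newtonSet (shift d A g)) = D ∧
      sValue d.factorial E (newtonSet (shift d A g)) ≠ ⊤ ∧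
      ∀ g' : MvPowerSeries (Fin 2) k, constantCoeff g' = 0 → IsMMax d A E g' 0 → dRes E (newtonSet (shift d A g')) = D →
        sValue d.factorial E (newtonSet (shift d A g')) ≤ sValue d.factorial E (newtonSet (shift d A g)) := by
  obtain ⟨g₁, hg₁, hmax₁, hD₁⟩ := hne
  -- the non-annihilation input (`¬ Exit₃`)
  have hnz : ∀ g : MvPowerSeries (Fin 2) k, constantCoeff g = 0 → (newtonSet (shift d A g)).Nonempty := fun g hg => by
    rw [← flagTuple_zero_shear]
    exact newtonSet_flagTuple_nonempty hex hg (map_zero _)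
  -- validity ⟺ `|excExp| = M`, the maximal `m`
  set M : ℕ := mOf d A E g₁ 0 with hM
  have hval : ∀ g : MvPowerSeries (Fin 2) k, constantCoeff g = 0 →
      (IsMMax d A E g 0 ↔ excExp E (newtonSet (shift d A g)) 0 + excExp E (newtonSet (shift d A g)) 1 = M) := by
    intro g hg
    rw [← mOf_zero_right]
    exact isMMax_iff_mOf_eq hg₁ hmax₁ hg
  have hmle : ∀ g : MvPowerSeries (Fin 2) k, constantCoeff g = 0 →
      excExp E (newtonSet (shift d A g)) 0 + excExp E (newtonSet (shift d A g)) 1 ≤ M := fun g hg => by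
    rw [← mOf_zero_right]
    exact hmax₁ g hg
  -- the class, indexed by the exceptional exponents
  let K : Set (MvPowerSeries (Fin 2) k) :=
    {g | constantCoeff g = 0 ∧ IsMMax d A E g 0 ∧ dRes E (newtonSet (shift d A g)) = D}
  let c : MvPowerSeries (Fin 2) k → (Fin 2 →₀ ℕ) := fun g => excExp E (newtonSet (shift d A g))
  let f : MvPowerSeries (Fin 2) k → ℕ∞ := fun g => sValue d.factorial E (newtonSet (shift d A g))
  -- finitely many classes occur: `r ≤ (M, M)`
  have hfin : (c '' K).Finite := by
    refine (Set.finite_Iic (Finsupp.single (0 : Fin 2) M + Finsupp.single 1 M)).subset ?_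
    rintro r ⟨g, ⟨hg, -, -⟩, rfl⟩
    have hm := hmle g hg
    show excExp E (newtonSet (shift d A g)) ≤ Finsupp.single (0 : Fin 2) M + Finsupp.single 1 M
    intro i
    fin_cases i
    · show excExp E (newtonSet (shift d A g)) 0 ≤ (Finsupp.single (0 : Fin 2) M + Finsupp.single 1 M : Fin 2 →₀ ℕ) 0
      rw [Finsupp.add_apply, Finsupp.single_eq_same, Finsupp.single_eq_of_ne (by decide), add_zero]
      omega
    · show excExp E (newtonSet (shift d A g)) 1 ≤ (Finsupp.single (0 : Fin 2) M + Finsupp.single 1 M : Fin 2 →₀ ℕ) 1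
      rw [Finsupp.add_apply, Finsupp.single_eq_of_ne (by decide), Finsupp.single_eq_same, zero_add]
      omega
  -- every occurring class `(D, r)` attains: Per17 Prop. 5.3.5 for re-centrings, `hmax` discharged by validity + topness
  have hcl : ∀ r ∈ c '' K, ∃ g ∈ K, c g = r ∧ f g ≠ ⊤ ∧ ∀ g' ∈ K, c g' = r → f g' ≤ f g := by
    rintro r ⟨g₂, ⟨hg₂, hmax₂, hD₂⟩, hr₂⟩
    change excExp E (newtonSet (shift d A g₂)) = r at hr₂
    have hrM : r 0 + r 1 = M := by rw [← hr₂]; exact (hval g₂ hg₂).1 hmax₂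
    have hrE : ∀ i, i ∉ E → r i = 0 := by
      intro i hi
      rw [← hr₂]
      fin_cases i
      · exact (excExp_apply_zero _ _).trans (if_neg hi)
      · exact (excExp_apply_one _ _).trans (if_neg hi)
    have hmaxr : ∀ g : MvPowerSeries (Fin 2) k, constantCoeff g = 0 →
        (∀ i ∈ E, r i ≤ excExp E (newtonSet (shift d A g)) i) →
        D + r 0 + r 1 ≤ dRes E (newtonSet (shift d A g)) + excExp E (newtonSet (shift d A g)) 0 +
          excExp E (newtonSet (shift d A g)) 1 →
        dRes E (newtonSet (shift d A g)) = D ∧ excExp E (newtonSet (shift d A g)) = r := by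
      intro g hg hri hsum
      have hle : ∀ i, r i ≤ excExp E (newtonSet (shift d A g)) i := fun i => by
        by_cases hi : i ∈ E
        · exact hri i hi
        · rw [hrE i hi]; exact Nat.zero_le _
      have hm := hmle g hg
      have h0 := hle 0
      have h1' := hle 1
      have he0 : excExp E (newtonSet (shift d A g)) 0 = r 0 := by omega
      have he1 : excExp E (newtonSet (shift d A g)) 1 = r 1 := by omega
      have her : excExp E (newtonSet (shift d A g)) = r := by
        ext i
        fin_cases i
        · exact he0
        · exact he1
      have hvalg : IsMMax d A E g 0 := (hval g hg).2 (by omega)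
      have hDle := htop g hg hvalg
      exact ⟨by omega, her⟩
    obtain ⟨g, hg, hgD, hgr, hgfin, hge⟩ := exists_isGreatest_sFlag_shift hd E A D hD r hnz hmaxr ⟨g₂, hg₂, hD₂, hr₂⟩
      (fun g hg hgD _ => sFlag_ne_top_of_one_mem h1 (hnz g hg) (by rw [hgD]; exact hD))
    have hvalg : IsMMax d A E g 0 := (hval g hg).2 (by rw [hgr]; exact hrM)
    refine ⟨g, ⟨hg, hvalg, hgD⟩, hgr, sValue_ne_top_of_sFlag_ne_top _ E (by rw [hgD]; exact hD) hgfin, ?_⟩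
    rintro g' ⟨hg', -, hg'D⟩ hg'r
    change excExp E (newtonSet (shift d A g')) = r at hg'r
    exact sValue_le_sValue_of_sFlag_le _ E (by rw [hg'D, hgD]) (by rw [hg'r, hgr]) (by rw [hg'D]; exact hD)
      (hge g' hg' hg'D hg'r)
  obtain ⟨g, ⟨hg, hvalg, hgD⟩, hgfin, hge⟩ :=
    exists_isGreatest_of_finite_classes K c f hfin ⟨g₁, hg₁, hmax₁, hD₁⟩ hcl
  exact ⟨g, hg, hvalg, hgD, hgfin, fun g' hg' hval' hg'D => hge g' ⟨hg', hval', hg'D⟩⟩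

end Recentre

/-! ## §3 The top class of the flag family: `hattain₀` -/

section TopClass

variable {p : ℕ}

/-- **ONE ORIENTATION OF THE TOP `n = 0` CLASS ATTAINS `s`**: for the orientation `o`, among the admissible `n = 0` flags `(o, g, h)`
that are valid (`IsMMax`) with residual order `D > 0` — `D` bounding the `d`-component of every flag triple of the position — the
`s`-entry is finite and attains its maximum: by `exists_isGreatest_sValue_recentre` when the curve letter is a boundary letter of the
orientation (`1 ∈ orientE o E`: then `h = 0` throughout), and by the PAIR ATTAINMENT hypothesis `hpair` (Per17 Prop. 5.3.5 proper:
res-D-pv-056 AS stub-5's `…WildMonicFlagAttainPair`) otherwise. [cite: Perlega2020, Props. 7.4.5 (3), 7.4.6, 5.3.5, Lemma 7.4.11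
(arXiv:2011.14443 §7.4.3, §5.3)] -/
theorem exists_isGreatest_sValue_orient (hd : 0 < d) {A : Fin d → MvPowerSeries (Fin 2) k} {E : Finset (Fin 2)}
    (hex : ¬ Exit₃ p d A) {D : ℕ} (hD : 0 < D) (htop : ∀ w, IsFlagTriple d A E w → (ofLex w).1 ≤ D)
    (hpair : ∀ o : Bool, (1 : Fin 2) ∉ orientE o E →
      (∃ (g : MvPowerSeries (Fin 2) k) (h : PowerSeries k), constantCoeff g = 0 ∧ PowerSeries.constantCoeff h = 0 ∧
          IsMMax d (orientT o A) (orientE o E) g h ∧ dRes (orientE o E) (newtonSet (flagTuple d (orientT o A) g h)) = D) →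
      ∃ (g : MvPowerSeries (Fin 2) k) (h : PowerSeries k), constantCoeff g = 0 ∧ PowerSeries.constantCoeff h = 0 ∧
        IsMMax d (orientT o A) (orientE o E) g h ∧ dRes (orientE o E) (newtonSet (flagTuple d (orientT o A) g h)) = D ∧
        sValue d.factorial (orientE o E) (newtonSet (flagTuple d (orientT o A) g h)) ≠ ⊤ ∧
        ∀ (g' : MvPowerSeries (Fin 2) k) (h' : PowerSeries k), constantCoeff g' = 0 → PowerSeries.constantCoeff h' = 0 →
          IsMMax d (orientT o A) (orientE o E) g' h' → dRes (orientE o E) (newtonSet (flagTuple d (orientT o A) g' h')) = D →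
          sValue d.factorial (orientE o E) (newtonSet (flagTuple d (orientT o A) g' h')) ≤
            sValue d.factorial (orientE o E) (newtonSet (flagTuple d (orientT o A) g h)))
    (o : Bool)
    (hne : ∃ (g : MvPowerSeries (Fin 2) k) (h : PowerSeries k), constantCoeff g = 0 ∧ PowerSeries.constantCoeff h = 0 ∧
      IsN0 (orientE o E) h ∧ IsMMax d (orientT o A) (orientE o E) g h ∧
      dRes (orientE o E) (newtonSet (flagTuple d (orientT o A) g h)) = D) :
    ∃ (g : MvPowerSeries (Fin 2) k) (h : PowerSeries k), constantCoeff g = 0 ∧ PowerSeries.constantCoeff h = 0 ∧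
      IsN0 (orientE o E) h ∧ IsMMax d (orientT o A) (orientE o E) g h ∧
      dRes (orientE o E) (newtonSet (flagTuple d (orientT o A) g h)) = D ∧
      sValue d.factorial (orientE o E) (newtonSet (flagTuple d (orientT o A) g h)) ≠ ⊤ ∧
      ∀ (g' : MvPowerSeries (Fin 2) k) (h' : PowerSeries k), constantCoeff g' = 0 → PowerSeries.constantCoeff h' = 0 →
        IsN0 (orientE o E) h' → IsMMax d (orientT o A) (orientE o E) g' h' →
        dRes (orientE o E) (newtonSet (flagTuple d (orientT o A) g' h')) = D →
        sValue d.factorial (orientE o E) (newtonSet (flagTuple d (orientT o A) g' h')) ≤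
          sValue d.factorial (orientE o E) (newtonSet (flagTuple d (orientT o A) g h)) := by
  obtain ⟨g₀, h₀, hg₀, hh₀, hN0₀, hmax₀, hD₀⟩ := hne
  by_cases h1 : (1 : Fin 2) ∈ orientE o E
  · -- coordinate class: `h = 0` throughout
    have h0 : ∀ h : PowerSeries k, IsN0 (orientE o E) h → h = 0 := fun h hN => hN.resolve_left (not_not.mpr h1)
    obtain rfl := h0 h₀ hN0₀
    have htop' : ∀ g : MvPowerSeries (Fin 2) k, constantCoeff g = 0 → IsMMax d (orientT o A) (orientE o E) g 0 →
        dRes (orientE o E) (newtonSet (shift d (orientT o A) g)) ≤ D := by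
      intro g hg hmax
      have h := htop _ ⟨o, g, 0, hg, map_zero _, Or.inl (Or.inr rfl), hmax, rfl⟩
      rwa [flagTriple_zero_shear] at h
    rw [flagTuple_zero_shear] at hD₀
    obtain ⟨g, hg, hval, hgD, hfin, hge⟩ :=
      exists_isGreatest_sValue_recentre hd (not_exit₃_orientT o hex) h1 hD htop' ⟨g₀, hg₀, hmax₀, hD₀⟩
    refine ⟨g, 0, hg, map_zero _, Or.inr rfl, hval, by rw [flagTuple_zero_shear]; exact hgD,
      by rw [flagTuple_zero_shear]; exact hfin, fun g' h' hg' _ hN0' hmax' hD' => ?_⟩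
    obtain rfl := h0 h' hN0'
    rw [flagTuple_zero_shear] at hD' ⊢
    rw [flagTuple_zero_shear]
    exact hge g' hg' hmax' hD'
  · -- pair class: the hypothesis
    obtain ⟨g, h, hg, hh, hmax, hgD, hfin, hge⟩ := hpair o h1 ⟨g₀, h₀, hg₀, hh₀, hmax₀, hD₀⟩
    exact ⟨g, h, hg, hh, Or.inl h1, hmax, hgD, hfin, fun g' h' hg' hh' _ hmax' hD' => hge g' h' hg' hh' hmax' hD'⟩

/-- **THE BRIDGE — `hattain₀` OF `attainShape_isFlagTriple_of` AT `(A, E)` FROM PAIR ATTAINMENT**: at a non-`Exit₃` position with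
boundary `E`, if `D > 0` is the largest `d`-component of all flag triples and the class of `n = 0` triples with `d = D` is inhabited, then
that class has a member with FINITE `s` that DOMINATES the class — provided, for each orientation whose boundary misses the curve letter,
the pairs `(g, h)` attain (hypothesis `hpair`, the conclusion shape of stub-5's `…WildMonicFlagAttainPair`).  The orientations whose
boundary contains the curve letter are discharged here (`exists_isGreatest_sValue_recentre`, both the `sFlag` and the companion
regime).  [cite: Perlega2020, Prop. 7.4.10, Lemma 7.4.11, Props. 7.4.5 (3) / 7.4.6 / 5.3.5 (arXiv:2011.14443 §7.4.3 chunks p0092–p0095,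
§5.3 p0066)] -/
theorem hattain₀_of_pairAttain (hd : 0 < d) {A : Fin d → MvPowerSeries (Fin 2) k} {E : Finset (Fin 2)}
    (hex : ¬ Exit₃ p d A) {D : ℕ} (hD : 0 < D)
    (hexD : ∃ v, IsFlagTriple d A E v ∧ (ofLex v).1 = D ∧ (ofLex (ofLex v).2).1 = 0)
    (htop : ∀ w, IsFlagTriple d A E w → (ofLex w).1 ≤ D)
    (hpair : ∀ o : Bool, (1 : Fin 2) ∉ orientE o E →
      (∃ (g : MvPowerSeries (Fin 2) k) (h : PowerSeries k), constantCoeff g = 0 ∧ PowerSeries.constantCoeff h = 0 ∧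
          IsMMax d (orientT o A) (orientE o E) g h ∧ dRes (orientE o E) (newtonSet (flagTuple d (orientT o A) g h)) = D) →
      ∃ (g : MvPowerSeries (Fin 2) k) (h : PowerSeries k), constantCoeff g = 0 ∧ PowerSeries.constantCoeff h = 0 ∧
        IsMMax d (orientT o A) (orientE o E) g h ∧ dRes (orientE o E) (newtonSet (flagTuple d (orientT o A) g h)) = D ∧
        sValue d.factorial (orientE o E) (newtonSet (flagTuple d (orientT o A) g h)) ≠ ⊤ ∧
        ∀ (g' : MvPowerSeries (Fin 2) k) (h' : PowerSeries k), constantCoeff g' = 0 → PowerSeries.constantCoeff h' = 0 →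
          IsMMax d (orientT o A) (orientE o E) g' h' → dRes (orientE o E) (newtonSet (flagTuple d (orientT o A) g' h')) = D →
          sValue d.factorial (orientE o E) (newtonSet (flagTuple d (orientT o A) g' h')) ≤
            sValue d.factorial (orientE o E) (newtonSet (flagTuple d (orientT o A) g h))) :
    ∃ v, IsFlagTriple d A E v ∧ (ofLex v).1 = D ∧ (ofLex (ofLex v).2).1 = 0 ∧ (ofLex (ofLex v).2).2 ≠ ⊤ ∧
      ∀ w, IsFlagTriple d A E w → (ofLex w).1 = D → (ofLex (ofLex w).2).1 = 0 →
        (ofLex (ofLex w).2).2 ≤ (ofLex (ofLex v).2).2 := by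
  classical
  -- flag data `(o, g, h)` of the admissible `n = 0` flags that are valid with residual order `D`
  let K : Set (Bool × MvPowerSeries (Fin 2) k × PowerSeries k) :=
    {x | constantCoeff x.2.1 = 0 ∧ PowerSeries.constantCoeff x.2.2 = 0 ∧ IsN0 (orientE x.1 E) x.2.2 ∧
      IsMMax d (orientT x.1 A) (orientE x.1 E) x.2.1 x.2.2 ∧
      dRes (orientE x.1 E) (newtonSet (flagTuple d (orientT x.1 A) x.2.1 x.2.2)) = D}
  let f : Bool × MvPowerSeries (Fin 2) k × PowerSeries k → ℕ∞ :=
    fun x => sValue d.factorial (orientE x.1 E) (newtonSet (flagTuple d (orientT x.1 A) x.2.1 x.2.2))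
  -- dictionary: the triple of a member of `K` is `(D, 0, f x)`
  have htri : ∀ x ∈ K, flagTriple d (orientT x.1 A) (orientE x.1 E) x.2.1 x.2.2 = toLex (D, toLex (0, f x)) := by
    rintro x ⟨-, -, hN0, -, hDx⟩
    rw [flagTriple_of_isN0 hN0, hDx]
  have hmemK : ∀ x ∈ K, IsFlagTriple d A E (toLex (D, toLex (0, f x))) := by
    intro x hx
    obtain ⟨hg, hh, hN0, hmax, hDx⟩ := hx
    exact ⟨x.1, x.2.1, x.2.2, hg, hh, Or.inl hN0, hmax, (htri x ⟨hg, hh, hN0, hmax, hDx⟩).symm⟩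
  -- every `n = 0` triple with `d = D` comes from `K`
  have hofK : ∀ w, IsFlagTriple d A E w → (ofLex w).1 = D → (ofLex (ofLex w).2).1 = 0 →
      ∃ x ∈ K, w = toLex (D, toLex (0, f x)) := by
    rintro w ⟨o, g, h, hg, hh, hadm, hmax, rfl⟩ hwD hwn
    have hN0 : IsN0 (orientE o E) h := (flagTriple_snd_fst_eq_zero_iff hh hadm).1 hwn
    have hDx : dRes (orientE o E) (newtonSet (flagTuple d (orientT o A) g h)) = D := by
      rw [flagTriple_of_isN0 hN0] at hwD
      exact hwD
    exact ⟨(o, g, h), ⟨hg, hh, hN0, hmax, hDx⟩, htri (o, g, h) ⟨hg, hh, hN0, hmax, hDx⟩⟩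
  have hK : K.Nonempty := by
    obtain ⟨v, hv, hvD, hvn⟩ := hexD
    obtain ⟨x, hx, -⟩ := hofK v hv hvD hvn
    exact ⟨x, hx⟩
  -- classes = orientations (finitely many); each occurring class attains
  have hcl : ∀ o ∈ Prod.fst '' K, ∃ x ∈ K, x.1 = o ∧ f x ≠ ⊤ ∧ ∀ y ∈ K, y.1 = o → f y ≤ f x := by
    rintro o ⟨x₀, ⟨hg₀, hh₀, hN0₀, hmax₀, hD₀⟩, rfl⟩
    obtain ⟨g, h, hg, hh, hN0, hmax, hgD, hfin, hge⟩ := exists_isGreatest_sValue_orient hd hex hD htop hpair x₀.1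
      ⟨x₀.2.1, x₀.2.2, hg₀, hh₀, hN0₀, hmax₀, hD₀⟩
    refine ⟨(x₀.1, g, h), ⟨hg, hh, hN0, hmax, hgD⟩, rfl, hfin, fun y hy hyo => ?_⟩
    obtain ⟨hg', hh', hN0', hmax', hD'⟩ := hy
    show sValue d.factorial (orientE y.1 E) (newtonSet (flagTuple d (orientT y.1 A) y.2.1 y.2.2)) ≤
      sValue d.factorial (orientE x₀.1 E) (newtonSet (flagTuple d (orientT x₀.1 A) g h))
    rw [hyo] at hN0' hmax' hD' ⊢
    exact hge y.2.1 y.2.2 hg' hh' hN0' hmax' hD'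
  obtain ⟨x, hx, hfin, hge⟩ := exists_isGreatest_of_finite_classes K Prod.fst f (Set.toFinite _) hK hcl
  refine ⟨toLex (D, toLex (0, f x)), hmemK x hx, rfl, rfl, hfin, fun w hw hwD hwn => ?_⟩
  obtain ⟨y, hy, rfl⟩ := hofK w hw hwD hwn
  exact hge y hy

/-- The full boundary sees the curve letter in both orientations. -/
theorem one_mem_orientE_univ (o : Bool) : (1 : Fin 2) ∈ orientE o (Finset.univ : Finset (Fin 2)) := by
  cases o
  · exact Finset.mem_univ _
  · exact (PurePowerFlag.mem_swapE _ _).2 (Finset.mem_univ _)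

/-- **`hattain₀` HOLDS OUTRIGHT FOR THE FULL BOUNDARY `E = {V(x₁), V(x₂)}`**: both orientations are coordinate classes (`h = 0`), so no
pair attainment is needed — the top `n = 0` class of the flag triples of a non-`Exit₃` position with boundary `Finset.univ` has a member
with finite `s` dominating the class. [cite: Perlega2020, Props. 7.4.5 (3), 7.4.6, 7.4.10, Lemma 7.4.11 (arXiv:2011.14443 §7.4.3)] -/
theorem hattain₀_univ (hd : 0 < d) {A : Fin d → MvPowerSeries (Fin 2) k} (hex : ¬ Exit₃ p d A) {D : ℕ} (hD : 0 < D)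
    (hexD : ∃ v, IsFlagTriple d A Finset.univ v ∧ (ofLex v).1 = D ∧ (ofLex (ofLex v).2).1 = 0)
    (htop : ∀ w, IsFlagTriple d A Finset.univ w → (ofLex w).1 ≤ D) :
    ∃ v, IsFlagTriple d A Finset.univ v ∧ (ofLex v).1 = D ∧ (ofLex (ofLex v).2).1 = 0 ∧ (ofLex (ofLex v).2).2 ≠ ⊤ ∧
      ∀ w, IsFlagTriple d A Finset.univ w → (ofLex w).1 = D → (ofLex (ofLex w).2).1 = 0 →
        (ofLex (ofLex w).2).2 ≤ (ofLex (ofLex v).2).2 :=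
  hattain₀_of_pairAttain hd hex hD hexD htop fun o ho => absurd (one_mem_orientE_univ o) ho

end TopClass

end WildMonic

end Summit.ResolutionOfSingularities.ResolutionOfSingularities.Theorems
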